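import Summits.CriticalPhenomena.PercolationContinuityZ3.Theorems.PercNearOneGluingNoHeavyLowerTailSahiOneStepTwoCNF
import HarnessLib

/-!
# One-step scheme: `(2′)` AT CODIMENSION THREE for all pairs, REDUCED to good pivots of self-hull events at the codim-3 level

Support file (prover prim-ineq-prove-3 gen 37; `--supports stmt-CriticalPhenomena-4575`; memo
`run/shared/lean/prim/prim-ineq-prove-3/FINDING-G37-TOP-THREE-LAYERS.md` §5).  No definitions, no named facts, no sorries; ONE explicit hypothesis.

COROLLARY 2 (`osN_threshold_codimTwo_nonneg`) settles `(2′) ∀p` at the slot `{N_F ≥ |F|-2}` for all increasing pairs.  This file records the exact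
shape of what the next level needs.  The recursion of the kernel step `osN_threshold_goodPivot_step` at the slot `{N_F ≥ |F|-3}` calls the slot
`{N_{F∖e} ≥ |F∖e|-3}` (same codimension, handled by induction on `|F|`) and the slot `{N_{F∖e} ≥ |F∖e|-2}` (COROLLARY 2).  Replacing `B` first by its
`H`-hull (`osN_ind_ind_hgen_le_right`, hull idempotent: `hgen_hgen_eq`), the ONLY remaining input is a good pivot (`X̃ ≥ 0 ∧ Ψ ≥ 0` at the level
`t = |F|-4` on `F∖e`) for every increasing `F`-determined event that IS ITS OWN codim-3 hull — concretely a monotone CNF of clause width `≤ 3`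
(numerically such a pivot exists in every event scanned — > 10⁷ vertex evaluations, memo §5 — but NOT at every vertex: the vertex-uniform `Ψ` fails
already for `(x_u ∨ x_u') ∧ ⋀ (x_v ∨ x_w ∨ x_w')`, `|W| = 10`, at the apex `v` (exact, memo §5); a selection argument is required).

* `hgen_hgen_eq` — the `H`-hull operator is idempotent;
* `psi_of_coball` — CO-BALL LEMMA: if the inner section `B¹` contains the complement `{N ≥ t+1}` of the big ball, `Ψ` holds against every `B⁰`
  (unconditional; from `ball_real_mul_compl_inter_le`);
* `goodPivot_of_coball` — hence every increasing `F`-determined `B ⊇ {N_F ≥ |F|-2}` ("all bad sets are triples") has a good pivot at the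
  codim-3 level (with `exists_X_pivot`; interior densities);
* `osN_threshold_codimThree_nonneg_of_goodPivots` — `(hgood₃) → 0 ≤ n_{N_F ≥ |F|-3}(A,B)` for every product measure, every increasing `A` and
  every increasing `F`-determined `B`;
* `section_sdiff_eq_empty_of_bad_singleton`, `coball_subset_of_no_small_bad`, `goodPivots_codimThree_of_mixed` — `(hgood₃)` reduced to the
  MIXED case: self-hull events with no bad singleton but some bad pair (the bad-singleton case is an AND-literal, the no-small-bad-set case is
  the co-ball case).  The missing input is a good-pivot SELECTION for hulls with a bad pair (memo §5: `(hgood₃)`, numerically without exception;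
  gen-38 memo `FINDING-G38-PIVOT-WINDOW.md`: block-symmetric census to n ≈ 100 and the Ψ-identity `…SahiOneStepPsiIdentity`).
-/

noncomputable section

namespace Summit.CriticalPhenomena.PercolationContinuityZ3.Theorems

namespace SahiOneStep

open Finset
open scoped Classical

variable {ι : Type*}

/-! ## The hull operator is idempotent -/
section Hull

/-- `hull_H (hull_H A) = hull_H A` for the `H`-generated hull `{ω | ∀ ω' ⊇ ω, ω' ∈ H → ω' ∈ A}`. [this work] -/
theorem hgen_hgen_eq (H A : Set (Set ι)) :
    {ω : Set ι | ∀ ω' : Set ι, ω ⊆ ω' → ω' ∈ H → ω' ∈ {ω : Set ι | ∀ ω' : Set ι, ω ⊆ ω' → ω' ∈ H → ω' ∈ A}} =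
      {ω : Set ι | ∀ ω' : Set ι, ω ⊆ ω' → ω' ∈ H → ω' ∈ A} := by
  ext ω
  simp only [Set.mem_setOf_eq]
  constructor
  · intro h ω' hωω' hH
    exact h ω' hωω' hH ω' subset_rfl hH
  · intro h ω' hωω' hH ω'' hω'ω'' hH''
    exact h ω'' (hωω'.trans hω'ω'') hH''

end Hull

/-! ## The co-ball lemma: `Ψ` is automatic when the inner section contains the complement of the big ball -/
section Coball

variable [Fintype ι]

open MeasureTheory
open Literature.Probability.Percolation (DeterminedBy determinedBy_iff)
open Literature.Probability.LatticeModels (prodBernoulli)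
open SahiE3Sections (determinedBy_section_insert)

/-- **Co-ball lemma.**  If the increasing `F`-determined event `B1` contains the complement `{N_F ≥ t+1}` of the big ball `{N_F < t+1}`, then the
`Ψ`-inequality of the one-step scheme holds for `B1` against EVERY event `B0`:
`ℓ¹(1−b¹)(ℓ⁰b⁰ − β⁰) ≤ ℓ⁰(1−b⁰)(ℓ¹b¹ − β¹)`.  Proof: `D = B1ᶜ` lies inside the big ball, so the claim reduces to "a decreasing event
prefers the smaller ball" (`ball_real_mul_compl_inter_le`) and `β⁰ ≥ b⁰ − (1 − ℓ⁰)`.  (At the codim-3 slot this is the case "all bad sets of the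
hull have size 3"; FINDING-G37 §5.) [this work] -/
theorem psi_of_coball (p : ι → unitInterval) (F : Finset ι) (t : ℕ) {B1 : Set (Set ι)} (hB1 : IsUpperSet B1)
    (hB1F : DeterminedBy B1 (↑F : Set ι)) (hco : {ω : Set ι | t + 1 ≤ (F.filter (· ∈ ω)).card} ⊆ B1) (B0 : Set (Set ι)) :
    (prodBernoulli p).real {ω : Set ι | (F.filter (· ∈ ω)).card < t} * (1 - (prodBernoulli p).real B1) *
        ((prodBernoulli p).real {ω : Set ι | (F.filter (· ∈ ω)).card < t + 1} * (prodBernoulli p).real B0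
          - (prodBernoulli p).real (B0 ∩ {ω : Set ι | (F.filter (· ∈ ω)).card < t + 1})) ≤
      (prodBernoulli p).real {ω : Set ι | (F.filter (· ∈ ω)).card < t + 1} * (1 - (prodBernoulli p).real B0) *
        ((prodBernoulli p).real {ω : Set ι | (F.filter (· ∈ ω)).card < t} * (prodBernoulli p).real B1
          - (prodBernoulli p).real (B1 ∩ {ω : Set ι | (F.filter (· ∈ ω)).card < t})) := by
  set μ := prodBernoulli p with hμ
  set L1 : Set (Set ι) := {ω : Set ι | (F.filter (· ∈ ω)).card < t} with hL1
  set L0 : Set (Set ι) := {ω : Set ι | (F.filter (· ∈ ω)).card < t + 1} with hL0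
  -- (a) the decreasing event `B1ᶜ` prefers the smaller ball
  have ha : μ.real L1 * μ.real (B1ᶜ ∩ L0) ≤ μ.real L0 * μ.real (B1ᶜ ∩ L1) := ball_real_mul_compl_inter_le p F hB1 hB1F t
  -- `B1ᶜ` lies inside the big ball
  have hDL0 : B1ᶜ ∩ L0 = B1ᶜ := by
    refine Set.inter_eq_left.2 fun ω hω => ?_
    by_contra h
    exact hω (hco (by rw [hL0, Set.mem_setOf_eq, not_lt] at h; exact h))
  have mD : μ.real B1ᶜ = 1 - μ.real B1 := probReal_compl_eq_one_sub MeasurableSet.of_discrete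
  have mDL1 : μ.real (B1ᶜ ∩ L1) = μ.real L1 - μ.real (B1 ∩ L1) := by
    have h := measureReal_inter_add_sdiff (μ := μ) (s := L1) (t := B1) MeasurableSet.of_discrete
    have e1 : L1 ∩ B1 = B1 ∩ L1 := Set.inter_comm _ _
    have e2 : L1 \ B1 = B1ᶜ ∩ L1 := by ext ω; simp only [Set.mem_sdiff, Set.mem_inter_iff, Set.mem_compl_iff]; tauto
    rw [e1, e2] at h; linarith
  rw [hDL0, mD, mDL1] at ha
  -- (b) `β⁰ ≥ b⁰ − (1 − ℓ⁰)`
  have hb : μ.real B0 ≤ μ.real (B0 ∩ L0) + (1 - μ.real L0) := by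
    have h1 : μ.real B0 ≤ μ.real (B0 ∩ L0) + μ.real (B0 \ L0) := by
      rw [measureReal_inter_add_sdiff (μ := μ) (s := B0) (t := L0) MeasurableSet.of_discrete]
    have h2 : μ.real (B0 \ L0) ≤ μ.real L0ᶜ := measureReal_mono (fun ω hω => hω.2)
    have h3 : μ.real L0ᶜ = 1 - μ.real L0 := probReal_compl_eq_one_sub MeasurableSet.of_discrete
    linarith
  have hl1 : 0 ≤ μ.real L1 := measureReal_nonneg
  have hb1 : 0 ≤ 1 - μ.real B1 := by rw [← mD]; exact measureReal_nonneg
  have hb0 : 0 ≤ 1 - μ.real B0 := by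
    have : μ.real B0ᶜ = 1 - μ.real B0 := probReal_compl_eq_one_sub MeasurableSet.of_discrete
    rw [← this]; exact measureReal_nonneg
  have hl0 : μ.real L0 ≤ 1 := by
    have : μ.real L0ᶜ = 1 - μ.real L0 := probReal_compl_eq_one_sub MeasurableSet.of_discrete
    linarith [(measureReal_nonneg : 0 ≤ μ.real L0ᶜ)]
  have k1 := mul_le_mul_of_nonneg_left ha hb0
  have k2 : μ.real L1 * (1 - μ.real B1) * (μ.real L0 * μ.real B0 - μ.real (B0 ∩ L0)) ≤
      μ.real L1 * (1 - μ.real B1) * ((1 - μ.real L0) * (1 - μ.real B0)) :=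
    mul_le_mul_of_nonneg_left (by nlinarith [hb, hl0]) (mul_nonneg hl1 hb1)
  nlinarith [k1, k2]

/-- **Good pivot when the event contains the codim-2 co-ball.**  For an interior product measure and an increasing `F`-determined `B` with
`{N_F ≥ |F|-2} ⊆ B` (`|F| ≥ 4`) — at the codim-3 slot: "every bad set of the hull has size exactly 3" — some `e ∈ F` satisfies both one-step
inequalities at the level `|F|-4` on `F ∖ e`: `X̃` by `exists_X_pivot` (averaging over all of `F`), `Ψ` by the co-ball lemma.  This discharges the
hypothesis of `osN_threshold_codimThree_nonneg_of_goodPivots` for such events (the events with bad sets of size `≤ 2` only are vertex-cover events,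
`vcClass_goodPivot`; the mixed case is the open selection problem `(hgood₃)` of the memo). [this work] -/
theorem goodPivot_of_coball (p : ι → unitInterval) (F : Finset ι) (hp : ∀ e ∈ F, 0 < (p e : ℝ) ∧ (p e : ℝ) < 1) (h4 : 4 ≤ F.card)
    {B : Set (Set ι)} (hB : IsUpperSet B) (hBF : DeterminedBy B (↑F : Set ι))
    (hco : {ω : Set ι | F.card - 2 ≤ (F.filter (· ∈ ω)).card} ⊆ B) :
    ∃ e ∈ F,
      (prodBernoulli p).real {ω : Set ι | ((F.erase e).filter (· ∈ ω)).card < F.card - 4} *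
          (prodBernoulli p).real ({ω : Set ι | ω \ {e} ∈ B} ∩ {ω : Set ι | ((F.erase e).filter (· ∈ ω)).card < F.card - 4 + 1}) ≤
        (prodBernoulli p).real {ω : Set ι | ((F.erase e).filter (· ∈ ω)).card < F.card - 4 + 1} *
          (prodBernoulli p).real ({ω : Set ι | insert e ω ∈ B} ∩ {ω : Set ι | ((F.erase e).filter (· ∈ ω)).card < F.card - 4}) ∧
      (prodBernoulli p).real {ω : Set ι | ((F.erase e).filter (· ∈ ω)).card < F.card - 4} *
          (1 - (prodBernoulli p).real {ω : Set ι | insert e ω ∈ B}) *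
          ((prodBernoulli p).real {ω : Set ι | ((F.erase e).filter (· ∈ ω)).card < F.card - 4 + 1} *
              (prodBernoulli p).real {ω : Set ι | ω \ {e} ∈ B}
            - (prodBernoulli p).real ({ω : Set ι | ω \ {e} ∈ B} ∩ {ω : Set ι | ((F.erase e).filter (· ∈ ω)).card < F.card - 4 + 1})) ≤
        (prodBernoulli p).real {ω : Set ι | ((F.erase e).filter (· ∈ ω)).card < F.card - 4 + 1} *
          (1 - (prodBernoulli p).real {ω : Set ι | ω \ {e} ∈ B}) *
          ((prodBernoulli p).real {ω : Set ι | ((F.erase e).filter (· ∈ ω)).card < F.card - 4} *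
              (prodBernoulli p).real {ω : Set ι | insert e ω ∈ B}
            - (prodBernoulli p).real ({ω : Set ι | insert e ω ∈ B} ∩ {ω : Set ι | ((F.erase e).filter (· ∈ ω)).card < F.card - 4})) := by
  have hFne : F.Nonempty := Finset.card_pos.1 (by omega)
  obtain ⟨e, heF, hX⟩ := exists_X_pivot p F hp hB hBF (F.card - 4) F subset_rfl hFne (fun e he hne => absurd he hne)
  refine ⟨e, heF, hX, ?_⟩
  have hcoe : (↑(F.erase e) : Set ι) = (↑F : Set ι) \ {e} := Finset.coe_erase e F
  refine psi_of_coball p (F.erase e) (F.card - 4) (isUpperSet_section_insert hB e)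
    (by rw [hcoe]; exact determinedBy_section_insert hBF e) (fun ω hω => ?_) {ω : Set ι | ω \ {e} ∈ B}
  -- `N_{F∖e}(ω) ≥ |F|-3` forces `N_F(insert e ω) ≥ |F|-2`, hence `insert e ω ∈ B`
  rw [Set.mem_setOf_eq] at hω
  show insert e ω ∈ B
  apply hco
  rw [Set.mem_setOf_eq]
  have hcard : (insert e ((F.erase e).filter (· ∈ ω))).card = ((F.erase e).filter (· ∈ ω)).card + 1 :=
    Finset.card_insert_of_notMem (by simp [Finset.mem_filter])
  refine le_trans (show F.card - 2 ≤ ((F.erase e).filter (· ∈ ω)).card + 1 by omega) ?_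
  rw [← hcard]
  refine Finset.card_le_card fun i hi => ?_
  rw [Finset.mem_insert] at hi
  simp only [Finset.mem_filter, Set.mem_insert_iff]
  rcases hi with rfl | hi
  · exact ⟨heF, Or.inl rfl⟩
  · simp only [Finset.mem_filter, Finset.mem_erase] at hi
    exact ⟨hi.1.2, Or.inr hi.2⟩

end Coball

/-! ## COROLLARY 3 reduced to good pivots at codimension three -/
section Main

variable [Fintype ι]

open MeasureTheory
open Literature.Probability.Percolation (DeterminedBy determinedBy_iff)
open Literature.Probability.LatticeModels (prodBernoulli)
open Literature.Probability.Percolation.DecisionTree (ind)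
open SahiE3Sections (determinedBy_section_insert determinedBy_section_sdiff)

/-- **`(2′)` at codimension three for ALL increasing pairs, conditionally on good pivots at the codim-3 level for self-hull events.**
Hypothesis `hgood`: every increasing `F`-determined `B ≠ ∅, univ` (`|F| ≥ 4`) which equals its own hull for the slot `{N_F ≥ |F|-3}` — i.e. a monotone
CNF of clause width `≤ 3` — has a coordinate `e ∈ F` with `X̃_B(e) ≥ 0` and `Ψ_B(e) ≥ 0` at the level `t = |F|-4` on `F ∖ e` (the two inequalities
of `osN_threshold_goodPivot_step`).  Conclusion: `0 ≤ n_{N_F ≥ |F|-3}(A,B)` for every product measure, increasing `A`, increasing `F`-determined `B`.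
Proof: strong induction on `|F|`; hull (`osN_ind_ind_hgen_le_right`, `hgen_hgen_eq`), kernel step, induction hypothesis for the inner section
(codimension 3 on `F ∖ e`) and COROLLARY 2 (`osN_threshold_codimTwo_nonneg`) for the outer sections (codimension 2 on `F ∖ e`). [this work] -/
theorem osN_threshold_codimThree_nonneg_of_goodPivots (p : ι → unitInterval)
    (hgood : ∀ (F : Finset ι) (B : Set (Set ι)), 4 ≤ F.card → IsUpperSet B → DeterminedBy B (↑F : Set ι) → B.Nonempty → B ≠ Set.univ →
      {ω : Set ι | ∀ ω' : Set ι, ω ⊆ ω' → ω' ∈ {ω : Set ι | F.card - 3 ≤ (F.filter (· ∈ ω)).card} → ω' ∈ B} = B →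
      ∃ e ∈ F,
      (prodBernoulli p).real {ω : Set ι | ((F.erase e).filter (· ∈ ω)).card < F.card - 4} *
          (prodBernoulli p).real ({ω : Set ι | ω \ {e} ∈ B} ∩ {ω : Set ι | ((F.erase e).filter (· ∈ ω)).card < F.card - 4 + 1}) ≤
        (prodBernoulli p).real {ω : Set ι | ((F.erase e).filter (· ∈ ω)).card < F.card - 4 + 1} *
          (prodBernoulli p).real ({ω : Set ι | insert e ω ∈ B} ∩ {ω : Set ι | ((F.erase e).filter (· ∈ ω)).card < F.card - 4}) ∧
      (prodBernoulli p).real {ω : Set ι | ((F.erase e).filter (· ∈ ω)).card < F.card - 4} *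
          (1 - (prodBernoulli p).real {ω : Set ι | insert e ω ∈ B}) *
          ((prodBernoulli p).real {ω : Set ι | ((F.erase e).filter (· ∈ ω)).card < F.card - 4 + 1} *
              (prodBernoulli p).real {ω : Set ι | ω \ {e} ∈ B}
            - (prodBernoulli p).real ({ω : Set ι | ω \ {e} ∈ B} ∩ {ω : Set ι | ((F.erase e).filter (· ∈ ω)).card < F.card - 4 + 1})) ≤
        (prodBernoulli p).real {ω : Set ι | ((F.erase e).filter (· ∈ ω)).card < F.card - 4 + 1} *
          (1 - (prodBernoulli p).real {ω : Set ι | ω \ {e} ∈ B}) *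
          ((prodBernoulli p).real {ω : Set ι | ((F.erase e).filter (· ∈ ω)).card < F.card - 4} *
              (prodBernoulli p).real {ω : Set ι | insert e ω ∈ B}
            - (prodBernoulli p).real ({ω : Set ι | insert e ω ∈ B} ∩ {ω : Set ι | ((F.erase e).filter (· ∈ ω)).card < F.card - 4})))
    (F : Finset ι) {A B : Set (Set ι)} (hA : IsUpperSet A) (hB : IsUpperSet B) (hBF : DeterminedBy B (↑F : Set ι)) :
    0 ≤ osN p {ω : Set ι | F.card - 3 ≤ (F.filter (· ∈ ω)).card} (ind A) (ind B) := by
  induction hn : F.card using Nat.strong_induction_on generalizing F A B with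
  | _ n ih =>
  subst hn
  by_cases h4 : F.card < 4
  · rw [show F.card - 3 = 0 by omega, threshold_zero, osN_ind_ind_univ]
  push Not at h4
  -- pass to the hull `Bs`
  refine le_trans ?_ (osN_ind_ind_hgen_le_right p (isUpperSet_threshold F (F.card - 3)) hA hB)
  set Bs : Set (Set ι) := {ω : Set ι | ∀ ω' : Set ι, ω ⊆ ω' → ω' ∈ {ω : Set ι | F.card - 3 ≤ (F.filter (· ∈ ω)).card} → ω' ∈ B}
    with hBs
  have hBsu : IsUpperSet Bs := isUpperSet_hgen _ _
  have hBsF : DeterminedBy Bs (↑F : Set ι) := determinedBy_hgen (determinedBy_threshold F (F.card - 3)) hBF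
  have hBss : {ω : Set ι | ∀ ω' : Set ι, ω ⊆ ω' → ω' ∈ {ω : Set ι | F.card - 3 ≤ (F.filter (· ∈ ω)).card} → ω' ∈ Bs} = Bs := by
    rw [hBs]; exact hgen_hgen_eq _ _
  rcases Bs.eq_empty_or_nonempty with hBe | hBne
  · rw [hBe, osN_ind_ind_empty_right]
  by_cases hBu : Bs = Set.univ
  · rw [hBu, osN_ind_ind_univ_snd]
  obtain ⟨e, heF, hX, hΨ⟩ := hgood F Bs h4 hBsu hBsF hBne hBu hBss
  -- bookkeeping of the block `F = insert e (F ∖ e)` and of the levels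
  have hce : (F.erase e).card = F.card - 1 := Finset.card_erase_of_mem heF
  have hlt : (F.erase e).card < F.card := Finset.card_erase_lt_of_mem heF
  have e3 : (F.erase e).card - 3 = F.card - 4 := by rw [hce]; omega
  have e2 : (F.erase e).card - 2 = F.card - 4 + 1 := by rw [hce]; omega
  have hcoe : (↑(F.erase e) : Set ι) = (↑F : Set ι) \ {e} := Finset.coe_erase e F
  have hslot : {ω : Set ι | F.card - 3 ≤ (F.filter (· ∈ ω)).card} =
      {ω : Set ι | F.card - 4 + 1 ≤ ((insert e (F.erase e)).filter (· ∈ ω)).card} := by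
    rw [Finset.insert_erase heF, show F.card - 4 + 1 = F.card - 3 by omega]
  rw [hslot]
  refine osN_threshold_goodPivot_step p (F.notMem_erase e) (F.card - 4) hA hBsu ?_ ?_ ?_ hX hΨ
  · -- inner sections: codimension 3 on `F ∖ e` — induction hypothesis
    have h := ih _ hlt (F.erase e) (isUpperSet_section_insert hA e) (isUpperSet_section_insert hBsu e)
      (by rw [hcoe]; exact determinedBy_section_insert hBsF e) rfl
    rwa [e3] at h
  · -- mixed sections: codimension 2 on `F ∖ e` — COROLLARY 2
    have h := osN_threshold_codimTwo_nonneg p (F.erase e) (isUpperSet_section_insert hA e) (isUpperSet_section_sdiff hBsu e)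
      (by rw [hcoe]; exact determinedBy_section_sdiff hBsF e)
    rwa [e2] at h
  · -- outer sections: codimension 2 on `F ∖ e` — COROLLARY 2
    have h := osN_threshold_codimTwo_nonneg p (F.erase e) (isUpperSet_section_sdiff hA e) (isUpperSet_section_sdiff hBsu e)
      (by rw [hcoe]; exact determinedBy_section_sdiff hBsF e)
    rwa [e2] at h

/-! ## Reduction of the hypothesis to events with a bad pair and no bad singleton -/

omit [Fintype ι] in
/-- If the configuration "all of `F` except `i`" is not in the increasing `F`-determined event `B`, the outer section of `B` at `i` is empty
(so `i` is an AND-literal of `B` and a good pivot, `goodPivot_of_section_sdiff_empty`). [this work] -/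
theorem section_sdiff_eq_empty_of_bad_singleton (F : Finset ι) {B : Set (Set ι)} (hB : IsUpperSet B) (hBF : DeterminedBy B (↑F : Set ι))
    {i : ι} (hbad : (↑(F.erase i) : Set ι) ∉ B) : {ω : Set ι | ω \ {i} ∈ B} = ∅ := by
  rw [determinedBy_iff] at hBF
  ext ω
  simp only [Set.mem_setOf_eq, Set.mem_empty_iff_false, iff_false]
  intro hω
  apply hbad
  -- `ω ∖ {i}` agrees on `F` with `(ω ∖ {i}) ∩ F ⊆ F.erase i`
  have h1 : (ω \ {i}) ∩ (↑F : Set ι) ∈ B := by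
    rw [← hBF (ω \ {i}) ((ω \ {i}) ∩ ↑F) (by rw [Set.inter_assoc, Set.inter_self])]
    exact hω
  refine hB (fun j hj => ?_) h1
  rw [Finset.mem_coe, Finset.mem_erase]
  simp only [Set.mem_inter_iff, Set.mem_sdiff, Set.mem_singleton_iff, Finset.mem_coe] at hj
  exact ⟨hj.1.2, hj.2⟩

omit [Fintype ι] in
/-- If every configuration "all of `F` except at most two points" lies in the increasing `F`-determined event `B`, then `B` contains the
codim-2 co-ball `{N_F ≥ |F|-2}` (hypothesis of `goodPivot_of_coball`). [this work] -/
theorem coball_subset_of_no_small_bad (F : Finset ι) {B : Set (Set ι)} (hBF : DeterminedBy B (↑F : Set ι))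
    (hgood2 : ∀ T ⊆ F, T.card ≤ 2 → (↑(F \ T) : Set ι) ∈ B) :
    {ω : Set ι | F.card - 2 ≤ (F.filter (· ∈ ω)).card} ⊆ B := by
  rw [determinedBy_iff] at hBF
  intro ω hω
  rw [Set.mem_setOf_eq] at hω
  set T := F.filter (· ∉ ω) with hT
  have hTc : T.card ≤ 2 := by
    have := Finset.card_filter_add_card_filter_not (s := F) (fun i => i ∈ ω)
    rw [hT]; omega
  have hagree : ω ∩ (↑F : Set ι) = (↑(F \ T) : Set ι) ∩ ↑F := by
    ext j
    simp only [Set.mem_inter_iff, Finset.mem_coe, Finset.mem_sdiff, hT, Finset.mem_filter, not_and, not_not]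
    tauto
  rw [hBF ω _ hagree]
  exact hgood2 T (Finset.filter_subset _ _) hTc

/-- **The hypothesis of `osN_threshold_codimThree_nonneg_of_goodPivots` reduced to the mixed case.**  For an interior product measure it suffices
to produce good pivots (at the level `|F|-4`) for increasing `F`-determined self-hull events that have NO bad singleton (`F ∖ {i} ∈ B` for all `i`)
but SOME bad pair (`F ∖ {a,b} ∉ B`, `a ≠ b`): the other events are handled by `goodPivot_of_section_sdiff_empty` (bad singleton) and
`goodPivot_of_coball` (no bad set of size `≤ 2`).  (Numerically the mixed case always has a good pivot, but not at a predictable vertex; memo §5.) [this work] -/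
theorem goodPivots_codimThree_of_mixed (p : ι → unitInterval) (hp : ∀ e, 0 < (p e : ℝ) ∧ (p e : ℝ) < 1)
    (hmixed : ∀ (F : Finset ι) (B : Set (Set ι)), 4 ≤ F.card → IsUpperSet B → DeterminedBy B (↑F : Set ι) → B.Nonempty → B ≠ Set.univ →
      {ω : Set ι | ∀ ω' : Set ι, ω ⊆ ω' → ω' ∈ {ω : Set ι | F.card - 3 ≤ (F.filter (· ∈ ω)).card} → ω' ∈ B} = B →
      (∀ i ∈ F, (↑(F.erase i) : Set ι) ∈ B) → (∃ a ∈ F, ∃ b ∈ F, a ≠ b ∧ (↑(F \ {a, b}) : Set ι) ∉ B) →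
      ∃ e ∈ F,
      (prodBernoulli p).real {ω : Set ι | ((F.erase e).filter (· ∈ ω)).card < F.card - 4} *
          (prodBernoulli p).real ({ω : Set ι | ω \ {e} ∈ B} ∩ {ω : Set ι | ((F.erase e).filter (· ∈ ω)).card < F.card - 4 + 1}) ≤
        (prodBernoulli p).real {ω : Set ι | ((F.erase e).filter (· ∈ ω)).card < F.card - 4 + 1} *
          (prodBernoulli p).real ({ω : Set ι | insert e ω ∈ B} ∩ {ω : Set ι | ((F.erase e).filter (· ∈ ω)).card < F.card - 4}) ∧
      (prodBernoulli p).real {ω : Set ι | ((F.erase e).filter (· ∈ ω)).card < F.card - 4} *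
          (1 - (prodBernoulli p).real {ω : Set ι | insert e ω ∈ B}) *
          ((prodBernoulli p).real {ω : Set ι | ((F.erase e).filter (· ∈ ω)).card < F.card - 4 + 1} *
              (prodBernoulli p).real {ω : Set ι | ω \ {e} ∈ B}
            - (prodBernoulli p).real ({ω : Set ι | ω \ {e} ∈ B} ∩ {ω : Set ι | ((F.erase e).filter (· ∈ ω)).card < F.card - 4 + 1})) ≤
        (prodBernoulli p).real {ω : Set ι | ((F.erase e).filter (· ∈ ω)).card < F.card - 4 + 1} *
          (1 - (prodBernoulli p).real {ω : Set ι | ω \ {e} ∈ B}) *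
          ((prodBernoulli p).real {ω : Set ι | ((F.erase e).filter (· ∈ ω)).card < F.card - 4} *
              (prodBernoulli p).real {ω : Set ι | insert e ω ∈ B}
            - (prodBernoulli p).real ({ω : Set ι | insert e ω ∈ B} ∩ {ω : Set ι | ((F.erase e).filter (· ∈ ω)).card < F.card - 4})))
    (F : Finset ι) (B : Set (Set ι)) (h4 : 4 ≤ F.card) (hB : IsUpperSet B) (hBF : DeterminedBy B (↑F : Set ι)) (hBne : B.Nonempty)
    (hBu : B ≠ Set.univ)
    (hself : {ω : Set ι | ∀ ω' : Set ι, ω ⊆ ω' → ω' ∈ {ω : Set ι | F.card - 3 ≤ (F.filter (· ∈ ω)).card} → ω' ∈ B} = B) :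
    ∃ e ∈ F,
      (prodBernoulli p).real {ω : Set ι | ((F.erase e).filter (· ∈ ω)).card < F.card - 4} *
          (prodBernoulli p).real ({ω : Set ι | ω \ {e} ∈ B} ∩ {ω : Set ι | ((F.erase e).filter (· ∈ ω)).card < F.card - 4 + 1}) ≤
        (prodBernoulli p).real {ω : Set ι | ((F.erase e).filter (· ∈ ω)).card < F.card - 4 + 1} *
          (prodBernoulli p).real ({ω : Set ι | insert e ω ∈ B} ∩ {ω : Set ι | ((F.erase e).filter (· ∈ ω)).card < F.card - 4}) ∧
      (prodBernoulli p).real {ω : Set ι | ((F.erase e).filter (· ∈ ω)).card < F.card - 4} *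
          (1 - (prodBernoulli p).real {ω : Set ι | insert e ω ∈ B}) *
          ((prodBernoulli p).real {ω : Set ι | ((F.erase e).filter (· ∈ ω)).card < F.card - 4 + 1} *
              (prodBernoulli p).real {ω : Set ι | ω \ {e} ∈ B}
            - (prodBernoulli p).real ({ω : Set ι | ω \ {e} ∈ B} ∩ {ω : Set ι | ((F.erase e).filter (· ∈ ω)).card < F.card - 4 + 1})) ≤
        (prodBernoulli p).real {ω : Set ι | ((F.erase e).filter (· ∈ ω)).card < F.card - 4 + 1} *
          (1 - (prodBernoulli p).real {ω : Set ι | ω \ {e} ∈ B}) *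
          ((prodBernoulli p).real {ω : Set ι | ((F.erase e).filter (· ∈ ω)).card < F.card - 4} *
              (prodBernoulli p).real {ω : Set ι | insert e ω ∈ B}
            - (prodBernoulli p).real ({ω : Set ι | insert e ω ∈ B} ∩ {ω : Set ι | ((F.erase e).filter (· ∈ ω)).card < F.card - 4})) := by
  -- (i) a bad singleton is an AND-literal
  by_cases h1 : ∃ i ∈ F, (↑(F.erase i) : Set ι) ∉ B
  · obtain ⟨i, hi, hbad⟩ := h1
    exact ⟨i, hi, goodPivot_of_section_sdiff_empty p (F.erase i) i (F.card - 4) hB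
      (section_sdiff_eq_empty_of_bad_singleton F hB hBF hbad)⟩
  push Not at h1
  -- (ii) a bad pair: the mixed case
  by_cases h2 : ∃ a ∈ F, ∃ b ∈ F, a ≠ b ∧ (↑(F \ {a, b}) : Set ι) ∉ B
  · exact hmixed F B h4 hB hBF hBne hBu hself h1 h2
  push Not at h2
  -- (iii) no bad set of size ≤ 2: the event contains the co-ball
  refine goodPivot_of_coball p F (fun e _ => hp e) h4 hB hBF (coball_subset_of_no_small_bad F hBF fun T hTF hTc => ?_)
  rcases T.eq_empty_or_nonempty with rfl | ⟨a, haT⟩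
  · rw [Finset.sdiff_empty]
    obtain ⟨ω, hω⟩ := hBne
    rw [determinedBy_iff] at hBF
    have hωF : ω ∩ (↑F : Set ι) ∈ B := by
      rw [← hBF ω (ω ∩ ↑F) (by rw [Set.inter_assoc, Set.inter_self])]; exact hω
    exact hB (fun j hj => hj.2) hωF
  · obtain ⟨b, hbT, hab⟩ := eq_pair_of_card_le_two hTc haT
    rw [hab]
    by_cases hne : a = b
    · subst hne
      rw [Finset.pair_eq_singleton, Finset.sdiff_singleton_eq_erase]
      exact h1 a (hTF haT)
    · exact h2 a (hTF haT) b (hTF hbT) hne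

end Main

end SahiOneStep

end Summit.CriticalPhenomena.PercolationContinuityZ3.Theorems
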